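import Summits.KontsevichZagierPeriods.KontsevichZagierPeriods.Theorems.FurushoPentagonHoffmanRelationInKZCubicalTransportAux

/-!
# `HoffmanRelationInKZ`, line `dilation-homotopy-transposition`: cubical transport — the charts

Support file for the stub `stub_cubicalTransport` of the crux `HoffmanRelationInKZ`
(stmt-KontsevichZagierPeriods-3930, route FurushoPentagon): the two concrete monomial charts.

* The **cubical chart** `Φ x = (T₁ x, …, T_n x)`, `T_m x = x₀⋯x_{m-1}`, of `ℝⁿ`
  (rows `S i = {j ≤ i}`): it is injective on the open unit cube (`x_i = T_{i+1} x / T_i x`) and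
  maps it ONTO the open ordered simplex `{1 > t₀ > ⋯ > t_{n-1} > 0}` (inverse `x_i = t_i/t_{i-1}`);
  its diagonal Jacobian entries are `T_i x`.
* The **spectator chart** `Ψ (u, x) = (u, Φ x)` of `ℝⁿ⁺¹` (rows `S 0 = {0}`,
  `S (i+1) = {1 ≤ j ≤ i+1}`): injective on `{y ∈ (0,1)ⁿ⁺¹ | y₀ < y₁}` with image
  `{(u, t) | t ∈ Δⁿ, 0 < u < t₀}`, and the same Jacobian `∏ᵢ T_i (tail y)`.

References: M. Kontsevich, D. Zagier, *Periods* (2001), §1.2 rule (2).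
-/

noncomputable section

open Set MeasureTheory MvPolynomial
open Literature.NumberTheory.Transcendental
open Literature.ModelTheory.ExponentialFields (IsSemialgebraic)

namespace Summit.KontsevichZagierPeriods.FurushoPentagon.HoffmanRelationInKZ

/-! ### The cubical chart `Φ x = (T₁ x, …, T_n x)` of the ordered simplex -/

/-- The coordinates of the cubical chart are the partial products: `(Φ x)_i = T_{i+1} x`.
[folklore] -/
theorem cubicalChart_apply {n : ℕ} (T : ℕ → (Fin n → ℝ) → ℝ)
    (hT : ∀ m x, T m x = ∏ j : Fin n, if (j : ℕ) < m then x j else 1)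
    (Φ : (Fin n → ℝ) → (Fin n → ℝ))
    (hΦ : ∀ x i, Φ x i = ∏ j ∈ Finset.univ.filter (fun j : Fin n => (j : ℕ) < (i : ℕ) + 1), x j)
    (x : Fin n → ℝ) (i : Fin n) : Φ x i = T ((i : ℕ) + 1) x := by
  rw [hΦ, hT, Finset.prod_filter]

/-- The diagonal Jacobian entry of the cubical chart: `∏_{j ≤ i, j ≠ i} x_j = T_i x`. [folklore] -/
theorem cubicalChart_diag {n : ℕ} (T : ℕ → (Fin n → ℝ) → ℝ)
    (hT : ∀ m x, T m x = ∏ j : Fin n, if (j : ℕ) < m then x j else 1) (x : Fin n → ℝ)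
    (i : Fin n) :
    ∏ k ∈ (Finset.univ.filter (fun j : Fin n => (j : ℕ) < (i : ℕ) + 1)).erase i, x k = T i x := by
  have : (Finset.univ.filter (fun j : Fin n => (j : ℕ) < (i : ℕ) + 1)).erase i =
      Finset.univ.filter (fun j : Fin n => (j : ℕ) < (i : ℕ)) := by
    ext j
    simp only [Finset.mem_erase, Finset.mem_filter, Finset.mem_univ, true_and, ne_eq,
      Fin.ext_iff]
    omega
  rw [this, hT, Finset.prod_filter]

/-- The cubical chart is injective on the open unit cube (`x_i = T_{i+1} x / T_i x`).
[folklore] -/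
theorem injOn_cubicalChart {n : ℕ} (T : ℕ → (Fin n → ℝ) → ℝ)
    (hT : ∀ m x, T m x = ∏ j : Fin n, if (j : ℕ) < m then x j else 1)
    (Φ : (Fin n → ℝ) → (Fin n → ℝ))
    (hΦ : ∀ x i, Φ x i = ∏ j ∈ Finset.univ.filter (fun j : Fin n => (j : ℕ) < (i : ℕ) + 1), x j) :
    InjOn Φ {x | ∀ i, x i ∈ Ioo (0 : ℝ) 1} := by
  intro x _ z hz hxz
  have hall : ∀ m, m ≤ n → T m x = T m z := by
    intro m hm
    rcases Nat.eq_zero_or_pos m with rfl | hpos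
    · rw [partialProd_zero T hT, partialProd_zero T hT]
    · obtain ⟨m', rfl⟩ : ∃ m', m = m' + 1 := ⟨m - 1, by omega⟩
      have := congr_fun hxz ⟨m', by omega⟩
      rwa [cubicalChart_apply T hT Φ hΦ, cubicalChart_apply T hT Φ hΦ] at this
  funext i
  have h1 := hall ((i : ℕ) + 1) i.isLt
  rw [partialProd_succ T hT, partialProd_succ T hT, hall i i.isLt.le, dif_pos i.isLt,
    dif_pos i.isLt] at h1
  exact mul_left_cancel₀ (partialProd_pos_le T hT hz i).1.ne' h1

/-- On the open unit cube the partial products decrease: `T (m + d) x ≤ T m x`, and strictly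
`T (m+1) x < T m x` as long as `m < n`. [folklore] -/
theorem partialProd_anti {n : ℕ} (T : ℕ → (Fin n → ℝ) → ℝ)
    (hT : ∀ m x, T m x = ∏ j : Fin n, if (j : ℕ) < m then x j else 1) {x : Fin n → ℝ}
    (hx : ∀ i, x i ∈ Ioo (0 : ℝ) 1) (m : ℕ) :
    (∀ d, T (m + d) x ≤ T m x) ∧ (m < n → T (m + 1) x < T m x) := by
  have hstep : ∀ m, T (m + 1) x ≤ T m x := by
    intro m
    rw [partialProd_succ T hT x m]
    have h0 := (partialProd_pos_le T hT hx m).1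
    split_ifs with h
    · exact mul_le_of_le_one_right h0.le (hx _).2.le
    · rw [mul_one]
  refine ⟨fun d => ?_, fun hm => ?_⟩
  · induction d with
    | zero => simp
    | succ d ih => exact (hstep (m + d)).trans ih
  · rw [partialProd_succ T hT x m, dif_pos hm]
    exact mul_lt_of_lt_one_right (partialProd_pos_le T hT hx m).1 (hx _).2

/-- The cubical chart maps the open unit cube ONTO the open ordered simplex
`{1 > t₀ > ⋯ > t_{n-1} > 0}` (inverse: `x_0 = t_0`, `x_i = t_i / t_{i-1}`). [folklore] -/
theorem image_cubicalChart {n : ℕ} (T : ℕ → (Fin n → ℝ) → ℝ)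
    (hT : ∀ m x, T m x = ∏ j : Fin n, if (j : ℕ) < m then x j else 1)
    (Φ : (Fin n → ℝ) → (Fin n → ℝ))
    (hΦ : ∀ x i, Φ x i = ∏ j ∈ Finset.univ.filter (fun j : Fin n => (j : ℕ) < (i : ℕ) + 1), x j) :
    Φ '' {x | ∀ i, x i ∈ Ioo (0 : ℝ) 1} = KZ.openOrderedSimplex n := by
  ext t
  constructor
  · rintro ⟨x, hx, rfl⟩
    refine ⟨fun i => ?_, fun i => ?_, ?_⟩
    · rw [cubicalChart_apply T hT Φ hΦ]; exact (partialProd_pos_le T hT hx _).1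
    · rw [cubicalChart_apply T hT Φ hΦ]
      exact partialProd_succ_lt_one T hT hx (Nat.zero_lt_of_lt i.isLt) _
    · intro i j hij
      rw [cubicalChart_apply T hT Φ hΦ, cubicalChart_apply T hT Φ hΦ]
      have hij' : (i : ℕ) < (j : ℕ) := hij
      obtain ⟨d, hd⟩ : ∃ d, (j : ℕ) + 1 = (i : ℕ) + 1 + 1 + d := ⟨(j : ℕ) - (i : ℕ) - 1, by omega⟩
      rw [hd]
      exact ((partialProd_anti T hT hx ((i : ℕ) + 1 + 1)).1 d).trans_lt
        ((partialProd_anti T hT hx ((i : ℕ) + 1)).2 (by omega))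
  · rintro ⟨h0, h1, hanti⟩
    -- the inverse chart
    have hlt : ∀ i : Fin n, t i < (if h : (i : ℕ) = 0 then 1 else t ⟨(i : ℕ) - 1, by omega⟩) := by
      intro i
      split_ifs with h
      · exact h1 i
      · exact hanti (Fin.lt_def.mpr (by simp; omega))
    have hpos : ∀ i : Fin n, 0 < (if h : (i : ℕ) = 0 then 1 else t ⟨(i : ℕ) - 1, by omega⟩) := by
      intro i
      split_ifs with h
      · exact one_pos
      · exact h0 _
    refine ⟨fun i => t i / (if h : (i : ℕ) = 0 then 1 else t ⟨(i : ℕ) - 1, by omega⟩), fun i =>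
      ⟨div_pos (h0 i) (hpos i), (div_lt_one (hpos i)).mpr (hlt i)⟩, ?_⟩
    funext i
    rw [cubicalChart_apply T hT Φ hΦ]
    have key : ∀ m (hm : m < n), T (m + 1) (fun i => t i / (if h : (i : ℕ) = 0 then 1 else
        t ⟨(i : ℕ) - 1, by omega⟩)) = t ⟨m, hm⟩ := by
      intro m
      induction m with
      | zero =>
        intro hm
        rw [partialProd_succ T hT, partialProd_zero T hT, one_mul, dif_pos hm]
        simp
      | succ m ih =>
        intro hm
        rw [partialProd_succ T hT, ih (by omega), dif_pos hm]
        simp only [Nat.add_eq_zero_iff, one_ne_zero, and_false, ↓reduceDIte, Nat.add_sub_cancel]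
        exact mul_div_cancel₀ _ (h0 _).ne'
    exact key i i.isLt

/-- The rows of the cubical chart are supported on `j ≤ i` and contain the diagonal. [folklore] -/
theorem cubicalChart_rows (n : ℕ) :
    (∀ i : Fin n, ∀ j ∈ Finset.univ.filter (fun j : Fin n => (j : ℕ) < (i : ℕ) + 1), j ≤ i) ∧
    (∀ i : Fin n, i ∈ Finset.univ.filter (fun j : Fin n => (j : ℕ) < (i : ℕ) + 1)) := by
  refine ⟨fun i j hj => ?_, fun i => ?_⟩
  · rw [Finset.mem_filter] at hj
    exact Fin.le_def.mpr (by omega)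
  · simp

/-! ### The spectator chart `Ψ (u, x) = (u, Φ x)` on `ℝⁿ⁺¹` -/

/-- The rows of the spectator chart are supported on `j ≤ i` and contain the diagonal.
[folklore] -/
theorem spectatorChart_rows (n : ℕ) :
    (∀ i : Fin (n + 1), ∀ j ∈ Finset.univ.filter (fun j : Fin (n + 1) =>
      (j : ℕ) < (i : ℕ) + 1 ∧ ((i : ℕ) = 0 ∨ 0 < (j : ℕ))), j ≤ i) ∧
    (∀ i : Fin (n + 1), i ∈ Finset.univ.filter (fun j : Fin (n + 1) =>
      (j : ℕ) < (i : ℕ) + 1 ∧ ((i : ℕ) = 0 ∨ 0 < (j : ℕ)))) := by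
  refine ⟨fun i j hj => ?_, fun i => ?_⟩
  · rw [Finset.mem_filter] at hj
    exact Fin.le_def.mpr (by omega)
  · simp only [Finset.mem_filter, Finset.mem_univ, true_and]
    omega

/-- The spectator coordinate is untouched: `(Ψ y)₀ = y₀`. [folklore] -/
theorem spectatorChart_zero {n : ℕ} (Ψ : (Fin (n + 1) → ℝ) → (Fin (n + 1) → ℝ))
    (hΨ : ∀ y i, Ψ y i = ∏ j ∈ Finset.univ.filter (fun j : Fin (n + 1) =>
      (j : ℕ) < (i : ℕ) + 1 ∧ ((i : ℕ) = 0 ∨ 0 < (j : ℕ))), y j) (y : Fin (n + 1) → ℝ) :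
    Ψ y 0 = y 0 := by
  rw [hΨ]
  have : Finset.univ.filter (fun j : Fin (n + 1) => (j : ℕ) < ((0 : Fin (n + 1)) : ℕ) + 1 ∧
      (((0 : Fin (n + 1)) : ℕ) = 0 ∨ 0 < (j : ℕ))) = {0} := by
    ext j
    simp only [Finset.mem_filter, Finset.mem_univ, true_and, Fin.val_zero, Finset.mem_singleton,
      Fin.ext_iff, zero_add, Nat.lt_one_iff, true_or, and_true]
  rw [this, Finset.prod_singleton]

/-- The other coordinates of the spectator chart are the partial products of the tail:
`(Ψ y)_{i+1} = T_{i+1} (tail y)`. [folklore] -/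
theorem spectatorChart_succ {n : ℕ} (T : ℕ → (Fin n → ℝ) → ℝ)
    (hT : ∀ m x, T m x = ∏ j : Fin n, if (j : ℕ) < m then x j else 1)
    (Ψ : (Fin (n + 1) → ℝ) → (Fin (n + 1) → ℝ))
    (hΨ : ∀ y i, Ψ y i = ∏ j ∈ Finset.univ.filter (fun j : Fin (n + 1) =>
      (j : ℕ) < (i : ℕ) + 1 ∧ ((i : ℕ) = 0 ∨ 0 < (j : ℕ))), y j) (y : Fin (n + 1) → ℝ) (i : Fin n) :
    Ψ y i.succ = T ((i : ℕ) + 1) (Fin.tail y) := by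
  rw [hΨ, Finset.prod_filter, Fin.prod_univ_succ, hT]
  simp only [Fin.val_succ, Fin.val_zero, Nat.add_eq_zero_iff, one_ne_zero, and_false,
    lt_self_iff_false, or_self, and_false, ↓reduceIte, one_mul, Nat.succ_pos', or_true, and_true,
    Nat.add_lt_add_iff_right, Fin.tail]

/-- The tail of the spectator chart is the cubical chart of the tail: `tail (Ψ y) = Φ (tail y)`.
[folklore] -/
theorem spectatorChart_tail {n : ℕ} (T : ℕ → (Fin n → ℝ) → ℝ)
    (hT : ∀ m x, T m x = ∏ j : Fin n, if (j : ℕ) < m then x j else 1)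
    (Φ : (Fin n → ℝ) → (Fin n → ℝ))
    (hΦ : ∀ x i, Φ x i = ∏ j ∈ Finset.univ.filter (fun j : Fin n => (j : ℕ) < (i : ℕ) + 1), x j)
    (Ψ : (Fin (n + 1) → ℝ) → (Fin (n + 1) → ℝ))
    (hΨ : ∀ y i, Ψ y i = ∏ j ∈ Finset.univ.filter (fun j : Fin (n + 1) =>
      (j : ℕ) < (i : ℕ) + 1 ∧ ((i : ℕ) = 0 ∨ 0 < (j : ℕ))), y j) (y : Fin (n + 1) → ℝ) :
    Fin.tail (Ψ y) = Φ (Fin.tail y) := by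
  funext i
  rw [Fin.tail, spectatorChart_succ T hT Ψ hΨ, cubicalChart_apply T hT Φ hΦ]

/-- The Jacobian of the spectator chart is that of the cubical chart of the tail:
`∏ᵢ (diagonal entries) = ∏_{i<n} T_i (tail y)`. [folklore] -/
theorem spectatorChart_diag {n : ℕ} (T : ℕ → (Fin n → ℝ) → ℝ)
    (hT : ∀ m x, T m x = ∏ j : Fin n, if (j : ℕ) < m then x j else 1) (y : Fin (n + 1) → ℝ) :
    ∏ i : Fin (n + 1), ∏ k ∈ (Finset.univ.filter (fun j : Fin (n + 1) =>
      (j : ℕ) < (i : ℕ) + 1 ∧ ((i : ℕ) = 0 ∨ 0 < (j : ℕ)))).erase i, y k =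
      ∏ i : Fin n, T i (Fin.tail y) := by
  rw [Fin.prod_univ_succ]
  have h0 : (Finset.univ.filter (fun j : Fin (n + 1) => (j : ℕ) < ((0 : Fin (n + 1)) : ℕ) + 1 ∧
      (((0 : Fin (n + 1)) : ℕ) = 0 ∨ 0 < (j : ℕ)))).erase 0 = ∅ := by
    ext j
    simp only [Finset.mem_erase, Finset.mem_filter, Finset.mem_univ, true_and, Fin.val_zero,
      ne_eq, Fin.ext_iff, Finset.notMem_empty, iff_false]
    omega
  rw [h0, Finset.prod_empty, one_mul]
  refine Finset.prod_congr rfl fun i _ => ?_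
  have h1 : (Finset.univ.filter (fun j : Fin (n + 1) => (j : ℕ) < ((i.succ : Fin (n + 1)) : ℕ) + 1 ∧
      (((i.succ : Fin (n + 1)) : ℕ) = 0 ∨ 0 < (j : ℕ)))).erase i.succ =
      Finset.univ.filter (fun j : Fin (n + 1) => 0 < (j : ℕ) ∧ (j : ℕ) < (i : ℕ) + 1) := by
    ext j
    simp only [Finset.mem_erase, Finset.mem_filter, Finset.mem_univ, true_and, Fin.val_succ,
      ne_eq, Fin.ext_iff]
    omega
  rw [h1, Finset.prod_filter, Fin.prod_univ_succ, hT]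
  simp only [Fin.val_succ, Fin.val_zero, lt_self_iff_false, false_and, ↓reduceIte, one_mul,
    Nat.succ_pos', true_and, Nat.add_lt_add_iff_right, Fin.tail]

/-- The spectator chart is injective on `{y ∈ (0,1)ⁿ⁺¹ | y₀ < y₁}`. [folklore] -/
theorem injOn_spectatorChart {n : ℕ} (T : ℕ → (Fin n → ℝ) → ℝ)
    (hT : ∀ m x, T m x = ∏ j : Fin n, if (j : ℕ) < m then x j else 1)
    (Φ : (Fin n → ℝ) → (Fin n → ℝ))
    (hΦ : ∀ x i, Φ x i = ∏ j ∈ Finset.univ.filter (fun j : Fin n => (j : ℕ) < (i : ℕ) + 1), x j)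
    (Ψ : (Fin (n + 1) → ℝ) → (Fin (n + 1) → ℝ))
    (hΨ : ∀ y i, Ψ y i = ∏ j ∈ Finset.univ.filter (fun j : Fin (n + 1) =>
      (j : ℕ) < (i : ℕ) + 1 ∧ ((i : ℕ) = 0 ∨ 0 < (j : ℕ))), y j) :
    InjOn Ψ {y | (∀ i, y i ∈ Ioo (0 : ℝ) 1) ∧ y 0 < y 1} := by
  intro y hy y' hy' h
  have h0 : y 0 = y' 0 := by
    rw [← spectatorChart_zero Ψ hΨ y, h, spectatorChart_zero Ψ hΨ y']
  have ht : Fin.tail y = Fin.tail y' := by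
    refine injOn_cubicalChart T hT Φ hΦ
      (show Fin.tail y ∈ {x : Fin n → ℝ | ∀ i, x i ∈ Ioo (0 : ℝ) 1} from fun i => hy.1 i.succ)
      (show Fin.tail y' ∈ {x : Fin n → ℝ | ∀ i, x i ∈ Ioo (0 : ℝ) 1} from fun i => hy'.1 i.succ) ?_
    rw [← spectatorChart_tail T hT Φ hΦ Ψ hΨ y, h, spectatorChart_tail T hT Φ hΦ Ψ hΨ y']
  rw [← Fin.cons_self_tail y, ← Fin.cons_self_tail y', h0, ht]

/-- The spectator chart maps `{y ∈ (0,1)ⁿ⁺¹ | y₀ < y₁}` ONTO `{(u, t) | t ∈ Δⁿ, 0 < u < t₀}`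
(`n ≥ 1`). [folklore] -/
theorem stub_spectatorChartImage : ∀ (n : ℕ), 0 < n → ∀ (T : ℕ → (Fin n → ℝ) → ℝ), (∀ m x, T m x = ∏ j : Fin n, if (j : ℕ) < m then x j else 1) → ∀ (Φ : (Fin n → ℝ) → (Fin n → ℝ)), (∀ x i, Φ x i = ∏ j ∈ Finset.univ.filter (fun j : Fin n => (j : ℕ) < (i : ℕ) + 1), x j) → ∀ (Ψ : (Fin (n + 1) → ℝ) → (Fin (n + 1) → ℝ)), (∀ y i, Ψ y i = ∏ j ∈ Finset.univ.filter (fun j : Fin (n + 1) => (j : ℕ) < (i : ℕ) + 1 ∧ ((i : ℕ) = 0 ∨ 0 < (j : ℕ))), y j) → Ψ '' {y : Fin (n + 1) → ℝ | (∀ i, y i ∈ Set.Ioo (0:ℝ) 1) ∧ y 0 < y 1} = {y : Fin (n + 1) → ℝ | Fin.tail y ∈ KZ.openOrderedSimplex n ∧ 0 < y 0 ∧ y 0 < y 1} := by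
  intro n hn T hT Φ hΦ Ψ hΨ
  have h1 : (1 : Fin (n + 1)) = Fin.succ ⟨0, hn⟩ :=
    Fin.ext (by rw [Fin.val_one', Nat.mod_eq_of_lt (by omega)]; rfl)
  have hT1 : ∀ x : Fin n → ℝ, T 1 x = x ⟨0, hn⟩ := fun x => by
    rw [partialProd_succ T hT, partialProd_zero T hT, one_mul, dif_pos hn]
  have hΨ1 : ∀ y, Ψ y 1 = y 1 := fun y => by
    rw [h1, spectatorChart_succ T hT Ψ hΨ, hT1]; rfl
  ext w
  constructor
  · rintro ⟨y, ⟨hy, hlt⟩, rfl⟩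
    refine ⟨?_, ?_, ?_⟩
    · rw [spectatorChart_tail T hT Φ hΦ Ψ hΨ, ← image_cubicalChart T hT Φ hΦ]
      exact mem_image_of_mem Φ (fun i => hy i.succ)
    · rw [spectatorChart_zero Ψ hΨ]; exact (hy 0).1
    · rw [spectatorChart_zero Ψ hΨ, hΨ1]; exact hlt
  · rintro ⟨hw, hw0, hw1⟩
    have hw1' : w 1 < 1 := by rw [h1]; exact hw.2.1 ⟨0, hn⟩
    rw [← image_cubicalChart T hT Φ hΦ] at hw
    obtain ⟨x, hx, hxw⟩ := hw
    have hx0 : x ⟨0, hn⟩ = w 1 := by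
      have := congr_fun hxw ⟨0, hn⟩
      rw [cubicalChart_apply T hT Φ hΦ, hT1] at this
      rw [this, h1]; rfl
    refine ⟨Fin.cons (w 0) x, ⟨fun i => ?_, ?_⟩, ?_⟩
    · refine Fin.cases ?_ (fun i => ?_) i
      · rw [Fin.cons_zero]; exact ⟨hw0, hw1.trans hw1'⟩
      · rw [Fin.cons_succ]; exact hx i
    · show (Fin.cons (w 0) x : Fin (n + 1) → ℝ) 0 < (Fin.cons (w 0) x : Fin (n + 1) → ℝ) 1
      rw [Fin.cons_zero, h1, Fin.cons_succ, hx0]; exact hw1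
    · rw [← Fin.cons_self_tail (Ψ _), spectatorChart_zero Ψ hΨ, spectatorChart_tail T hT Φ hΦ Ψ hΨ,
        Fin.cons_zero, Fin.tail_cons, hxw, Fin.cons_self_tail]

end Summit.KontsevichZagierPeriods.FurushoPentagon.HoffmanRelationInKZ
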